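import Summits.ResolutionOfSingularities.ResolutionOfSingularities.Theorems.FrobeniusLadderFRationalResolutionChartAlgebraFixedPoint
import Literature.AlgebraicGeometry.Resolution.LogChartEmbeddingRank
import HarnessLib

/-!
# Crux `FrobeniusLadder.FRationalResolution` (stmt-ResolutionOfSingularities-15317), line `redirect`,
# stub `stub_diagonalizableQuotientResolution` — **the torus-fixed point of a chart algebra: dimension
# bound `dim C_𝔓₀ ≤ dim A_𝔭` and Kato's condition (2.1)(i)** (point-blow-up recursion for the surface
# case over arbitrary fields, memo MEMO-15317-leafhand2-g6 §3–§4; continues `…ChartAlgebraFixedPoint`)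

Setting as in `…ChartAlgebraNormalForm` / `…ChartAlgebraFixedPoint`: a chart `φ : P → A`, a prime `𝔭`
with unit face `F_𝔭`, `L = ℤF_𝔭`, and a chart algebra `C = A[χ(Q)]` (`χ : Q → C` extending `φ` along
`P ≤ Q ⊆ ℤⁿ`); `𝔓` a prime of `C` over `𝔭` containing `χ(Q ∖ L)` — the torus-fixed point over `𝔭`
(e.g. of a blow-up chart `A[I/φ(a)]`). Results:

* `map_ideal_le_ideal`, `faceMonoid_le_faceMonoid` — Kato's ideal and unit face of `φ` at `𝔭` sit
  inside those of `χ` at `𝔓`;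
* **`ringKrullDim_le_rank_add_of_fixedPrime`** — Kato's inequality at the fixed point: if
  `𝔪_{A_𝔭} = I(𝔭, φ)A_𝔭 + (t₁, …, t_d)` then `dim C_𝔓 ≤ (n − rk F_𝔓(χ)^{gp}) + d` (for `Q` finitely
  generated and saturated: sharp embedding of `Q/F_𝔓(χ)`, `LogChart.embChart_dform`, and the power
  series bound `LogRegularCompleteStructure.ringKrullDim_le_rank_add`, Kato Lemma (2.3));
* **`ringKrullDim_le_of_fixedPrime`** — hence, for `φ` LOG REGULAR at `𝔭`: `dim C_𝔓 ≤ dim A_𝔭`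
  (birational modification: the dimension does not go up at the closed orbit);
* **`maximalIdeal_eq_map_ideal_of_fixedPrime`**, `isRegularLocalRing_quotient_of_fixedPrime` — at a point
  `𝔭` of zero-dimensional log stratum (`𝔭A_𝔭 = I(𝔭, φ)A_𝔭`) the fixed point has
  `𝔪_{C_𝔓} = I(𝔓, χ)C_𝔓`, so Kato's condition (2.1)(i) holds at `𝔓` with a zero-dimensional stratum,
  and **`isLogRegularAt_iff_of_fixedPrime`**: `χ` is log regular at `𝔓` iff `dim C_𝔓` equals the rank
  term — the recursion hypothesis "closed-stratum point" reproduces itself, and log regularity of the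
  blown-up chart at its fixed point is reduced to ONE dimension count.

Honest label: generic local algebra toward ONE leaf stub (no stub, crux or summit closed). No definitions,
no named facts, no sorry. [cite: Kato1994, Def. (2.1), Lemma (2.3), (10.1)] [cite: Niziol2006, §4]
-/

noncomputable section

-- single-problem summit: the doubled namespace component is forced
set_option linter.dupNamespace false

open IsLocalRing Literature.AlgebraicGeometry.Resolution Literature.AlgebraicGeometry.Resolution.LogChart
  Literature.AlgebraicGeometry.Resolution.LogRegularCompleteStructure
open Summit.ResolutionOfSingularities.ResolutionOfSingularities.Theorems.FRationalResolution.ChartAlgebraNormalForm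
open Summit.ResolutionOfSingularities.ResolutionOfSingularities.Theorems.FRationalResolution.ChartAlgebraFixedPoint

namespace Summit.ResolutionOfSingularities.ResolutionOfSingularities.Theorems.FRationalResolution.ChartAlgebraFixedPointDim

universe u

variable {A : Type u} [CommRing A] {n : ℕ} {P : AddSubmonoid (Fin n → ℤ)} {φ : Multiplicative P →* A}
  {𝔭 : Ideal A} [𝔭.IsPrime] {C : Type u} [CommRing C] [Algebra A C] {Q : AddSubmonoid (Fin n → ℤ)}
  {χ : Multiplicative Q →* C} {𝔓 : Ideal C} [𝔓.IsPrime]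

/-! ### Kato's ideal and unit face along `A → C` -/

omit [𝔭.IsPrime] [𝔓.IsPrime] in
/-- Kato's ideal of `φ` at `𝔭 = 𝔓 ∩ A` extends into Kato's ideal of `χ` at `𝔓`.
[cite: Kato1994, Def. (2.1)] -/
theorem map_ideal_le_ideal (hPQ : P ≤ Q)
    (hχ : ∀ p : P, χ (Multiplicative.ofAdd ⟨(p : Fin n → ℤ), hPQ p.2⟩) =
      algebraMap A C (φ (Multiplicative.ofAdd p)))
    (h𝔓 : 𝔓.comap (algebraMap A C) = 𝔭) :
    (ideal P φ 𝔭).map (algebraMap A C) ≤ ideal Q χ 𝔓 := by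
  rw [ideal, Ideal.map_span]
  refine Ideal.span_le.2 ?_
  rintro _ ⟨_, ⟨p, hp, rfl⟩, rfl⟩
  refine Ideal.subset_span ⟨⟨(p : Fin n → ℤ), hPQ p.2⟩, ?_, (hχ p)⟩
  change χ (Multiplicative.ofAdd ⟨(p : Fin n → ℤ), hPQ p.2⟩) ∈ 𝔓
  rw [hχ p]
  have : φ (Multiplicative.ofAdd p) ∈ 𝔓.comap (algebraMap A C) := by rw [h𝔓]; exact hp
  exact this

/-- The unit face of `φ` at `𝔭 = 𝔓 ∩ A` lies in the unit face of `χ` at `𝔓`. [cite: Kato1994, Def. (2.1)] -/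
theorem faceMonoid_le_faceMonoid (hPQ : P ≤ Q)
    (hχ : ∀ p : P, χ (Multiplicative.ofAdd ⟨(p : Fin n → ℤ), hPQ p.2⟩) =
      algebraMap A C (φ (Multiplicative.ofAdd p)))
    (h𝔓 : 𝔓.comap (algebraMap A C) = 𝔭) :
    faceMonoid P φ 𝔭 ≤ faceMonoid Q χ 𝔓 := by
  rintro f ⟨hf, hf𝔭⟩
  refine ⟨hPQ hf, ?_⟩
  intro h
  rw [val_of_mem Q χ (hPQ hf), hχ ⟨f, hf⟩] at h
  apply hf𝔭
  rw [val_of_mem P φ hf, ← h𝔓, Ideal.mem_comap]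
  exact h

/-- The image of `𝔭` in `C_𝔓` is controlled by d-form data of `A_𝔭`: if
`𝔪_{A_𝔭} ≤ I(𝔭, φ)A_𝔭 + (t)` then `𝔭·C_𝔓 ≤ I(𝔓, χ)C_𝔓 + (t)` (images of the `tₖ` under the local
map `A_𝔭 → C_𝔓`). [cite: Kato1994, Def. (2.1)] -/
theorem map_prime_le_of_dform (hPQ : P ≤ Q)
    (hχ : ∀ p : P, χ (Multiplicative.ofAdd ⟨(p : Fin n → ℤ), hPQ p.2⟩) =
      algebraMap A C (φ (Multiplicative.ofAdd p)))
    (h𝔓 : 𝔓.comap (algebraMap A C) = 𝔭) {d : ℕ} {t : Fin d → Localization.AtPrime 𝔭}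
    (hgen𝔭 : maximalIdeal (Localization.AtPrime 𝔭) ≤
      (ideal P φ 𝔭).map (algebraMap A (Localization.AtPrime 𝔭)) ⊔ Ideal.span (Set.range t)) :
    𝔭.map (algebraMap A (Localization.AtPrime 𝔓)) ≤
      (ideal Q χ 𝔓).map (algebraMap C (Localization.AtPrime 𝔓)) ⊔
        Ideal.span (Set.range fun k => Localization.localRingHom 𝔭 𝔓 (algebraMap A C) h𝔓.symm (t k)) := by
  set ρ := Localization.localRingHom 𝔭 𝔓 (algebraMap A C) h𝔓.symm with hρ
  have hfac : algebraMap A (Localization.AtPrime 𝔓) = ρ.comp (algebraMap A (Localization.AtPrime 𝔭)) := by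
    ext a
    rw [RingHom.comp_apply, hρ, Localization.localRingHom_to_map, IsScalarTower.algebraMap_apply A C]
  rw [hfac, ← Ideal.map_map, Localization.AtPrime.map_eq_maximalIdeal]
  refine (Ideal.map_mono hgen𝔭).trans ?_
  rw [Ideal.map_sup, Ideal.map_map, Ideal.map_span, ← Set.range_comp]
  refine sup_le_sup_right ?_ _
  have h2 : ρ.comp (algebraMap A (Localization.AtPrime 𝔭)) =
      (algebraMap C (Localization.AtPrime 𝔓)).comp (algebraMap A C) := by
    rw [← hfac, IsScalarTower.algebraMap_eq A C (Localization.AtPrime 𝔓)]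
  rw [h2, ← Ideal.map_map]
  exact Ideal.map_mono (map_ideal_le_ideal hPQ hχ h𝔓)

/-! ### The dimension bound at the fixed point -/

/-- **Kato's inequality at the torus-fixed point.** Let `𝔓` be a prime of the chart algebra
`C = A[χ(Q)]` over `𝔭` containing `χ(Q ∖ ℤF_𝔭)` (with (S)), `Q` finitely generated and saturated,
`C` Noetherian, and let `𝔪_{A_𝔭} ≤ I(𝔭, φ)A_𝔭 + (t₁, …, t_d)`. Then
`dim C_𝔓 ≤ (n − rk_ℤ F_𝔓(χ)^{gp}) + d`. [cite: Kato1994, Lemma (2.3), (10.1)] -/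
theorem ringKrullDim_le_rank_add_of_fixedPrime [IsNoetherianRing C] (hQ : Q.FG)
    (hsatQ : ∀ (v : Fin n → ℤ) (k : ℕ), 0 < k → k • v ∈ Q → v ∈ Q) (hPQ : P ≤ Q)
    (hχ : ∀ p : P, χ (Multiplicative.ofAdd ⟨(p : Fin n → ℤ), hPQ p.2⟩) =
      algebraMap A C (φ (Multiplicative.ofAdd p)))
    (hgen : Algebra.adjoin A (Set.range χ) = ⊤)
    (hS : ∀ q₁ ∈ Q, ∀ q₂ ∈ Q, q₁ + q₂ ∈ Submodule.span ℤ (faceMonoid P φ 𝔭 : Set (Fin n → ℤ)) →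
      q₁ ∈ Submodule.span ℤ (faceMonoid P φ 𝔭 : Set (Fin n → ℤ)))
    (h𝔓 : 𝔓.comap (algebraMap A C) = 𝔭)
    (hq : ∀ q : Q, (q : Fin n → ℤ) ∉ Submodule.span ℤ (faceMonoid P φ 𝔭 : Set (Fin n → ℤ)) →
      χ (Multiplicative.ofAdd q) ∈ 𝔓)
    {d : ℕ} {t : Fin d → Localization.AtPrime 𝔭} (ht : ∀ k, t k ∈ maximalIdeal (Localization.AtPrime 𝔭))
    (hgen𝔭 : maximalIdeal (Localization.AtPrime 𝔭) ≤
      (ideal P φ 𝔭).map (algebraMap A (Localization.AtPrime 𝔭)) ⊔ Ideal.span (Set.range t)) :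
    ringKrullDim (Localization.AtPrime 𝔓) ≤
      ((n - Module.finrank ℤ (Submodule.span ℤ (faceMonoid Q χ 𝔓 : Set (Fin n → ℤ))) + d : ℕ) :
      WithBot ℕ∞) := by
  classical
  haveI : IsNoetherianRing (Localization.AtPrime 𝔓) :=
    IsLocalization.isNoetherianRing 𝔓.primeCompl (Localization.AtPrime 𝔓) inferInstance
  have hface := isFaceOf_faceMonoid Q χ 𝔓
  obtain ⟨e, he⟩ := exists_isSharpEmbedding hQ hface hsatQ
  obtain ⟨π, hπ0, hπ1, -⟩ := hface.exists_proj hsatQ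
  obtain ⟨h0, hadd, hmax, hspan⟩ := embChart_dform he hπ0 hπ1
  set ρ := Localization.localRingHom 𝔭 𝔓 (algebraMap A C) h𝔓.symm with hρ
  let t' : Fin d → Localization.AtPrime 𝔓 := fun k => ρ (t k)
  have ht' : ∀ k, t' k ∈ maximalIdeal (Localization.AtPrime 𝔓) := by
    intro k
    rw [mem_maximalIdeal, mem_nonunits_iff]
    intro hu
    have := (ht k)
    rw [mem_maximalIdeal, mem_nonunits_iff] at this
    exact this ((isUnit_map_iff ρ (t k)).1 hu)
  have hgen' : maximalIdeal (Localization.AtPrime 𝔓) ≤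
      Ideal.span (embChart he π '' {w | w ∈ embMonoid he ∧ w ≠ 0}) ⊔ Ideal.span (Set.range t') := by
    rw [hspan, maximalIdeal_eq_sup_map hPQ hχ hgen hS h𝔓 hq]
    refine sup_le ?_ le_sup_left
    exact map_prime_le_of_dform hPQ hχ h𝔓 hgen𝔭
  have h := ringKrullDim_le_rank_add (embMonoid_fg he hQ) h0 hadd hmax ht' hgen'
  refine h.trans ?_
  have hr := Nat.add_le_add_right (rank_embMonoid_le he) d
  exact_mod_cast hr

/-- **The dimension does not go up at the fixed point: `dim C_𝔓 ≤ dim A_𝔭`** for a chart algebra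
`C = A[χ(Q)]` (`Q` finitely generated, saturated; `C` Noetherian; (S)) over a chart `φ` LOG REGULAR
at `𝔭`, at a prime `𝔓` over `𝔭` containing `χ(Q ∖ ℤF_𝔭)`. [cite: Kato1994, Lemma (2.3), (10.1)] -/
theorem ringKrullDim_le_of_fixedPrime [IsNoetherianRing A] [IsNoetherianRing C] (hQ : Q.FG)
    (hsatQ : ∀ (v : Fin n → ℤ) (k : ℕ), 0 < k → k • v ∈ Q → v ∈ Q) (hPQ : P ≤ Q)
    (hχ : ∀ p : P, χ (Multiplicative.ofAdd ⟨(p : Fin n → ℤ), hPQ p.2⟩) =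
      algebraMap A C (φ (Multiplicative.ofAdd p)))
    (hgen : Algebra.adjoin A (Set.range χ) = ⊤)
    (hS : ∀ q₁ ∈ Q, ∀ q₂ ∈ Q, q₁ + q₂ ∈ Submodule.span ℤ (faceMonoid P φ 𝔭 : Set (Fin n → ℤ)) →
      q₁ ∈ Submodule.span ℤ (faceMonoid P φ 𝔭 : Set (Fin n → ℤ)))
    (hreg : IsLogRegularAt P φ 𝔭) (h𝔓 : 𝔓.comap (algebraMap A C) = 𝔭)
    (hq : ∀ q : Q, (q : Fin n → ℤ) ∉ Submodule.span ℤ (faceMonoid P φ 𝔭 : Set (Fin n → ℤ)) →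
      χ (Multiplicative.ofAdd q) ∈ 𝔓) :
    ringKrullDim (Localization.AtPrime 𝔓) ≤ ringKrullDim (Localization.AtPrime 𝔭) := by
  obtain ⟨d, t, ht, hgen𝔭, hdim⟩ := exists_dform_of_isLogRegularAt P φ 𝔭 hreg
  refine (ringKrullDim_le_rank_add_of_fixedPrime hQ hsatQ hPQ hχ hgen hS h𝔓 hq ht hgen𝔭).trans ?_
  rw [hdim]
  have hmono : Module.finrank ℤ (Submodule.span ℤ (faceMonoid P φ 𝔭 : Set (Fin n → ℤ))) ≤
      Module.finrank ℤ (Submodule.span ℤ (faceMonoid Q χ 𝔓 : Set (Fin n → ℤ))) :=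
    Submodule.finrank_mono (Submodule.span_mono (faceMonoid_le_faceMonoid hPQ hχ h𝔓))
  have : n - Module.finrank ℤ (Submodule.span ℤ (faceMonoid Q χ 𝔓 : Set (Fin n → ℤ))) + d ≤
      d + (n - Module.finrank ℤ (Submodule.span ℤ (faceMonoid P φ 𝔭 : Set (Fin n → ℤ)))) := by omega
  exact_mod_cast this

/-! ### Zero-dimensional stratum reproduces itself -/

/-- **At a point of zero-dimensional log stratum the fixed point has `𝔪_{C_𝔓} = I(𝔓, χ)C_𝔓`.**
If `𝔭A_𝔭 ≤ I(𝔭, φ)A_𝔭` (the stratum of `𝔭` is a point, `…LogClosedStratumPoint`) then, at a prime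
`𝔓` of `C = A[χ(Q)]` over `𝔭` containing `χ(Q ∖ ℤF_𝔭)`, the maximal ideal of `C_𝔓` is Kato's
ideal of `χ`. [cite: Kato1994, Def. (2.1), (10.1)] -/
theorem maximalIdeal_eq_map_ideal_of_fixedPrime (hPQ : P ≤ Q)
    (hχ : ∀ p : P, χ (Multiplicative.ofAdd ⟨(p : Fin n → ℤ), hPQ p.2⟩) =
      algebraMap A C (φ (Multiplicative.ofAdd p)))
    (hgen : Algebra.adjoin A (Set.range χ) = ⊤)
    (hS : ∀ q₁ ∈ Q, ∀ q₂ ∈ Q, q₁ + q₂ ∈ Submodule.span ℤ (faceMonoid P φ 𝔭 : Set (Fin n → ℤ)) →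
      q₁ ∈ Submodule.span ℤ (faceMonoid P φ 𝔭 : Set (Fin n → ℤ)))
    (h𝔓 : 𝔓.comap (algebraMap A C) = 𝔭)
    (hq : ∀ q : Q, (q : Fin n → ℤ) ∉ Submodule.span ℤ (faceMonoid P φ 𝔭 : Set (Fin n → ℤ)) →
      χ (Multiplicative.ofAdd q) ∈ 𝔓)
    (h0 : maximalIdeal (Localization.AtPrime 𝔭) ≤
      (ideal P φ 𝔭).map (algebraMap A (Localization.AtPrime 𝔭))) :
    maximalIdeal (Localization.AtPrime 𝔓) = (ideal Q χ 𝔓).map (algebraMap C (Localization.AtPrime 𝔓)) := by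
  refine le_antisymm ?_ ?_
  · rw [maximalIdeal_eq_sup_map hPQ hχ hgen hS h𝔓 hq]
    refine sup_le ?_ le_rfl
    have h0' : maximalIdeal (Localization.AtPrime 𝔭) ≤
        (ideal P φ 𝔭).map (algebraMap A (Localization.AtPrime 𝔭)) ⊔
          Ideal.span (Set.range (Fin.elim0 : Fin 0 → Localization.AtPrime 𝔭)) :=
      h0.trans le_sup_left
    refine (map_prime_le_of_dform hPQ hχ h𝔓 h0').trans (sup_le le_rfl ?_)
    rw [Ideal.span_le]
    rintro _ ⟨k, -⟩
    exact k.elim0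
  · rw [← Localization.AtPrime.map_eq_maximalIdeal]
    exact Ideal.map_mono (ideal_le Q χ 𝔓)

/-- Hence Kato's condition (2.1)(i) at the fixed point, with a zero-dimensional stratum:
`C_𝔓/I(𝔓, χ)C_𝔓` is the residue field, a regular local ring of dimension `0`.
[cite: Kato1994, Def. (2.1)] -/
theorem isRegularLocalRing_quotient_of_fixedPrime (hPQ : P ≤ Q)
    (hχ : ∀ p : P, χ (Multiplicative.ofAdd ⟨(p : Fin n → ℤ), hPQ p.2⟩) =
      algebraMap A C (φ (Multiplicative.ofAdd p)))
    (hgen : Algebra.adjoin A (Set.range χ) = ⊤)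
    (hS : ∀ q₁ ∈ Q, ∀ q₂ ∈ Q, q₁ + q₂ ∈ Submodule.span ℤ (faceMonoid P φ 𝔭 : Set (Fin n → ℤ)) →
      q₁ ∈ Submodule.span ℤ (faceMonoid P φ 𝔭 : Set (Fin n → ℤ)))
    (h𝔓 : 𝔓.comap (algebraMap A C) = 𝔭)
    (hq : ∀ q : Q, (q : Fin n → ℤ) ∉ Submodule.span ℤ (faceMonoid P φ 𝔭 : Set (Fin n → ℤ)) →
      χ (Multiplicative.ofAdd q) ∈ 𝔓)
    (h0 : maximalIdeal (Localization.AtPrime 𝔭) ≤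
      (ideal P φ 𝔭).map (algebraMap A (Localization.AtPrime 𝔭))) :
    IsRegularLocalRing (Localization.AtPrime 𝔓 ⧸
        (ideal Q χ 𝔓).map (algebraMap C (Localization.AtPrime 𝔓))) ∧
      ringKrullDim (Localization.AtPrime 𝔓 ⧸
        (ideal Q χ 𝔓).map (algebraMap C (Localization.AtPrime 𝔓))) = 0 := by
  have heq := maximalIdeal_eq_map_ideal_of_fixedPrime hPQ hχ hgen hS h𝔓 hq h0
  let e : (Localization.AtPrime 𝔓 ⧸ maximalIdeal (Localization.AtPrime 𝔓)) ≃+*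
      (Localization.AtPrime 𝔓 ⧸ (ideal Q χ 𝔓).map (algebraMap C (Localization.AtPrime 𝔓))) :=
    Ideal.quotEquivOfEq heq
  letI : Field (Localization.AtPrime 𝔓 ⧸ maximalIdeal (Localization.AtPrime 𝔓)) :=
    Ideal.Quotient.field _
  refine ⟨IsRegularLocalRing.of_ringEquiv e, ?_⟩
  rw [← ringKrullDim_eq_of_ringEquiv e]
  exact ringKrullDim_eq_zero_of_isField (Field.toIsField _)

/-- **Log regularity of the blown-up chart at its fixed point is one dimension count.** Under the
hypotheses of `maximalIdeal_eq_map_ideal_of_fixedPrime`: `χ` is log regular at `𝔓` (Kato (2.1)) iff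
`dim C_𝔓 = n − rk_ℤ F_𝔓(χ)^{gp}`. [cite: Kato1994, Def. (2.1)] -/
theorem isLogRegularAt_iff_of_fixedPrime (hPQ : P ≤ Q)
    (hχ : ∀ p : P, χ (Multiplicative.ofAdd ⟨(p : Fin n → ℤ), hPQ p.2⟩) =
      algebraMap A C (φ (Multiplicative.ofAdd p)))
    (hgen : Algebra.adjoin A (Set.range χ) = ⊤)
    (hS : ∀ q₁ ∈ Q, ∀ q₂ ∈ Q, q₁ + q₂ ∈ Submodule.span ℤ (faceMonoid P φ 𝔭 : Set (Fin n → ℤ)) →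
      q₁ ∈ Submodule.span ℤ (faceMonoid P φ 𝔭 : Set (Fin n → ℤ)))
    (h𝔓 : 𝔓.comap (algebraMap A C) = 𝔭)
    (hq : ∀ q : Q, (q : Fin n → ℤ) ∉ Submodule.span ℤ (faceMonoid P φ 𝔭 : Set (Fin n → ℤ)) →
      χ (Multiplicative.ofAdd q) ∈ 𝔓)
    (h0 : maximalIdeal (Localization.AtPrime 𝔭) ≤
      (ideal P φ 𝔭).map (algebraMap A (Localization.AtPrime 𝔭))) :
    IsLogRegularAt Q χ 𝔓 ↔ ringKrullDim (Localization.AtPrime 𝔓) =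
      ((n - Module.finrank ℤ (Submodule.span ℤ ((fun p : Q => (p : Fin n → ℤ)) '' face Q χ 𝔓)) : ℕ) :
        WithBot ℕ∞) := by
  obtain ⟨hR, hd0⟩ := isRegularLocalRing_quotient_of_fixedPrime hPQ hχ hgen hS h𝔓 hq h0
  unfold IsLogRegularAt
  rw [hd0, zero_add]
  exact ⟨fun h => h.2, fun h => ⟨hR, h⟩⟩

end Summit.ResolutionOfSingularities.ResolutionOfSingularities.Theorems.FRationalResolution.ChartAlgebraFixedPointDim

end
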